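import Literature.IUT.HodgeArakelov.GroupTheoreticThetaMonoids
import Literature.IUT.HodgeArakelov.BadPrimeGaussianMonoidsProofs3
import Literature.IUT.HodgeArakelov.BadPrimeGaussianMonoidsCor36Proofs
import Literature.IUT.HodgeArakelov.TemperedThetaMonoidsSubdagProofs
import HarnessLib

/-!
# [IUTchII] Corollary 3.7 (i)(ii) — proof companion of `TemperedThetaMonoids.lean`: functoriality of the Gaussian
# monoids in the mono-theta environment («group-theoretic Gaussian monoids») and uniradiality of Gaussian monoids

S. Mochizuki, *Inter-universal Teichmüller theory II*, §3 "Tempered Gaussian Frobenioids", kurims Dec-2020 manuscript: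
Corollary 3.7 (Group-theoretic Gaussian Monoids and Uniradiality) (i) p. 111 l. 21 – p. 112 l. 6, (ii) p. 112 l. 7–37
[cite: Mochizuki2012, Cor 3.7 p.110]. Claim key DISPUTED (D-0012): nothing
disputed is asserted. PROOF-ONLY companion (abc-iut cell, layer L6, seat abc-iut-w4-d019 gen 4, row «IUTchII-COR37-DEF38-COVERAGE»;
nodes **IUTchII:Cor3.7(i)**, **IUTchII:Cor3.7(ii)**): NO `def`, NO `structure`, NO `instance`, NO new
`Prop` fact — theorems about objects already REAL in the tree: abc-iut-L6-t2's theta monoids `Ψ^ι_env = M^×_TM · θ^ℕ`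
(`TemperedThetaMonoids.ThetaEnvData.thetaMonoid`, `splitMonoid`), Gaussian monoids `Ψ_ξ`, `∞Ψ_ξ`, `Ψ_{2l·ξ}`, `Ψ_{F_ξ}(†F_v)`
(`gaussianMonoid`, `inftyGaussianMonoid`, `gaussianMonoid2l`, `frobenioidGaussianMonoid`, `piIso`, p404298); the isomorphisms of
theta-environment data `ThetaEnvData.Iso` of Prop 3.4 ("what an isomorphism `M^Θ_*(Π_v) ⥲ M^Θ_*(†F_v)` of projective systems of
mono-theta environments induces", `GroupTheoreticThetaMonoids` p412316); abc-iut-w4-d004's restriction isomorphisms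
`Ψ^ι_env ⥲ Ψ_ξ` pinned to the restriction map (`BadPrimeGaussianMonoidsProofs2` p413958) and Cor 3.6 (ii) transport
(`BadPrimeGaussianMonoidsProofs3` p412003); abc-iut-w5-d169's checkable content `Prop34iiUniradialContent` of Prop 3.4 (ii)
(`TemperedThetaMonoidsSubdagStatements` p414772, DEFINITION FROZEN) over abc-iut-L6-t1's `AbsTopMonoids` / `PairAut`.

* **Cor 3.7 (i)** («Each isomorphism of projective systems of mono-theta environments `M^Θ_*(Π_v) ⥲ M^Θ_*(†F_v)` induces
  compatible [in the evident sense] collections of isomorphisms … `Ψ^ι_env(M^Θ_*(Π_v)) ⥲ Ψ_ξ(M^Θ_*(Π_v)) ⥲ … ⥲ Ψ_ξ(M^Θ_*(†F_v)) ⥲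
  Ψ_{F_ξ}(†F_v)` … the isomorphisms that relate the upper left-hand portion … to the lower right-hand portion … arise from the
  functoriality of the algorithms involved, relative to isomorphisms of projective systems of mono-theta environments … the
  second display is obtained from the first display by considering the units»): for an isomorphism `I : E ⥲ E'` of
  theta-environment data and restriction families `r`, `r'` intertwined by `I` through a comparison `m` of the constant targets
  (`hcomp`, the functoriality input of the restriction algorithm of Cor 2.8/3.5), the labelwise transport `piIso T m` carries
  `Ψ_ξ`, `∞Ψ_ξ`, `Ψ_{2l·ξ}` onto `Ψ_{m∘ξ}`, `∞Ψ_{m∘ξ}`, `Ψ_{2l·(m∘ξ)}` (`map_piIso_gaussianMonoid`, `…infty…`, `…2l`), whence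
  the MIDDLE isomorphism `Ψ_ξ(M^Θ_*(Π_v)) ⥲ Ψ_ξ(M^Θ_*(†F_v))` pinned to `piIso T m` (`exists_gaussianMonoidIso`); the Π_v-side
  restriction isomorphism INDUCES the †F_v-side one, pinned to the restriction and making the square with
  `I.thetaMonoidIso` commute, uniquely (`cor37_i_square`, `cor37_i_restrictionIso_unique`); composing with Cor 3.6 (ii) gives the
  end-to-end isomorphism `Ψ^ι_env(M^Θ_*(Π_v)) ⥲ Ψ_{F_ξ}(†F_v)` pinned through the labelled Kummer copies (`cor37_i_chain`); the
  unit version (second display) and the compatibility of the transports with the diagonal Galois actions «↷↷»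
  (`cor37_i_units_square`, `piIso_diagonalAction_compat`).
* **Cor 3.7 (ii)** («the functorial algorithms `Π_v ↦ Ψ_gau(M^Θ_*(Π_v))` … obtained by composing the algorithms of
  Proposition 1.2, (i); Corollary 3.5, (ii), (iii), depend on the cyclotomic rigidity isomorphism of Corollary 1.11, (b) … hence
  fail to be compatible, relative to the displayed diagrams of (i), with automorphisms of … the pair
  `G_v(M^Θ_*(†F_v))_⟨F_l^⋇⟩ ↷ Ψ_{F_ξ}(†F_v)^{×μ}` which arise from automorphisms of … the pair `G_v(M^Θ_*(†F_v))_⟨F_l^⋇⟩ ↷ Ψ_{F_ξ}(†F_v)^×`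
  [cf. Remarks 1.11.1, (i), (b); 1.8.1] — in the sense that this algorithm, as given, only admits a uniradial formulation»):
  the checkable content of Prop 3.4 (ii) (`Prop34iiUniradialContent`, constant monoids) TRANSPORTS along any `G`-equivariant
  identification `ιU : O^×(G) ⥲ U` of the unit group `U = Ψ_{F_ξ}(†F_v)^×` — in print the diagonal `(Ψ^×_{†C_v})_⟨F_l^⋇⟩`
  composed with the Kummer isomorphism of Cor 3.6 (i)/(iii) (`frobenioidGaussianMonoid_eq`, `image_units_eq_unitDiagonal`,
  `isUnit_splitMonoid_iff`): there is an automorphism `ψ` of `U^{×μ} = U / U_tors` commuting with every `G`-action on `U^{×μ}`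
  compatible with that on `U`, induced by an automorphism of the pair `G ↷ U` over `1 ∈ Aut(G)`, and induced through `ιU` by NO
  automorphism of the TM-pair `G ↷ O^⊳(G)` over `1` — the rigidifying datum of Cor 1.11 (b) through which `Ψ_gau` is computed
  (`cor37ii_uniradialContent_of_prop34ii`); hence from the named facts `Rmk1111_a/_b` (`…_of_rmk1111`, CONDITIONAL on the two
  FACT-LIST rows by design, via p416097) — the unconditional instance at the genuine producers is p429824's
  `prop34iiUniradialContent_genuineOfModel` fed to the same theorem.
HONEST LIMITS: statements at abc-iut-L6-t2's abstraction (value-level theta-environment data, abstract restriction families and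
Kummer copies); the instantiation at the genuine `θ_env` data is abc-iut-w4-d004's / abc-iut-w5-d192's genuine-record files, cited by
name, not restated; no side taken on [IUTchIII] Cor 3.12; typed ≠ proved.
-/

namespace Literature.IUT.HodgeArakelov

namespace TemperedThetaMonoids

open BadPrimeGaussianMonoids

universe u v w

/-! ### 1. Cor 3.7 (i): the labelwise transport of Gaussian monoids («functoriality of the algorithms involved») -/

section Transport

variable {T : Type u} {M : Type v} {M' : Type w} [CommMonoid M] [CommMonoid M']

/-- Bookkeeping: the image of a submonoid under a monoid isomorphism is its preimage under the inverse. [folklore] -/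
private theorem map_toMonoidHom_eq_comap_symm {A : Type v} {B : Type w} [CommMonoid A] [CommMonoid B] (f : A ≃* B)
    (K : Submonoid A) : K.map f.toMonoidHom = K.comap f.symm.toMonoidHom := by
  ext x
  rw [Submonoid.mem_map_equiv]
  rfl

/-- **IUTchII:Cor3.7(i)** (kurims p.111): an isomorphism `m` of the constant targets (what an isomorphism of projective systems
of mono-theta environments induces on `Ψ_cns`, Prop 3.4 (ii)), copied at every label `|t| ∈ F_l^⋇`, carries the Gaussian monoid
`Ψ_ξ` ONTO the Gaussian monoid of the transported value-profile `m ∘ ξ`. [cite: Mochizuki2012, Cor 3.7 (i) p.111] -/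
theorem map_piIso_gaussianMonoid (m : M ≃* M') (ξ : T → M) :
    (gaussianMonoid ξ).map (piIso T m).toMonoidHom = gaussianMonoid (fun t => m (ξ t)) := by
  rw [map_toMonoidHom_eq_comap_symm]
  change frobenioidGaussianMonoid m.symm ξ = _
  rw [frobenioidGaussianMonoid_eq, MulEquiv.symm_symm]

/-- **IUTchII:Cor3.7(i)** (kurims p.111), `∞`-row: the same transport carries `∞Ψ_ξ` onto `∞Ψ_{m∘ξ}`.
[cite: Mochizuki2012, Cor 3.7 (i) p.111] -/
theorem map_piIso_inftyGaussianMonoid (m : M ≃* M') (ξ : T → M) :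
    (inftyGaussianMonoid ξ).map (piIso T m).toMonoidHom = inftyGaussianMonoid (fun t => m (ξ t)) := by
  rw [map_toMonoidHom_eq_comap_symm]
  change inftyFrobenioidGaussianMonoid m.symm ξ = _
  rw [inftyFrobenioidGaussianMonoid_eq, MulEquiv.symm_symm]

/-- **IUTchII:Cor3.7(i)** (kurims p.111) with Cor 3.5 (ii) «compatible with the equalities `Ψ_{2l·ξ₁} = Ψ_{2l·ξ₂}`»: the transport
carries `Ψ_{2l·ξ}` onto `Ψ_{2l·(m∘ξ)}`. [cite: Mochizuki2012, Cor 3.7 (i) p.111] -/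
theorem map_piIso_gaussianMonoid2l (twoL : ℕ) (m : M ≃* M') (ξ : T → M) :
    (gaussianMonoid2l twoL ξ).map (piIso T m).toMonoidHom = gaussianMonoid2l twoL (fun t => m (ξ t)) := by
  rw [map_toMonoidHom_eq_comap_symm]
  change (gaussianMonoid2l twoL ξ).comap (piIso T m.symm).toMonoidHom = _
  rw [comap_piIso_gaussianMonoid2l, MulEquiv.symm_symm]

/-- **IUTchII:Cor3.7(i)** (kurims p.111), the MIDDLE isomorphism `Ψ_ξ(M^Θ_*(Π_v)) ⥲ Ψ_ξ(M^Θ_*(†F_v))` of the first display: it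
exists and is PINNED — its underlying map is the labelwise transport `piIso T m`. [cite: Mochizuki2012, Cor 3.7 (i) p.111] -/
theorem exists_gaussianMonoidIso (m : M ≃* M') (ξ : T → M) :
    ∃ γ : gaussianMonoid ξ ≃* gaussianMonoid (fun t => m (ξ t)),
      ∀ x, ((γ x : gaussianMonoid (fun t => m (ξ t))) : T → M') = piIso T m x :=
  ⟨((piIso T m).submonoidMap (gaussianMonoid ξ)).trans (MulEquiv.submonoidCongr (map_piIso_gaussianMonoid m ξ)),
    fun _ => rfl⟩

/-- **IUTchII:Cor3.7(i)** (kurims p.111), `∞`-row of the middle isomorphism, pinned to `piIso T m` and hence compatible with the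
inclusions `Ψ_ξ ⊆ ∞Ψ_ξ` («⋃» of the display). [cite: Mochizuki2012, Cor 3.7 (i) p.111] -/
theorem exists_inftyGaussianMonoidIso (m : M ≃* M') (ξ : T → M) :
    ∃ γ : inftyGaussianMonoid ξ ≃* inftyGaussianMonoid (fun t => m (ξ t)),
      ∀ x, ((γ x : inftyGaussianMonoid (fun t => m (ξ t))) : T → M') = piIso T m x :=
  ⟨((piIso T m).submonoidMap (inftyGaussianMonoid ξ)).trans
      (MulEquiv.submonoidCongr (map_piIso_inftyGaussianMonoid m ξ)), fun _ => rfl⟩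

/-- **IUTchII:Cor3.7(i)** (kurims p.111) «↷↷ … compatible»: the labelwise transport intertwines the DIAGONAL actions
`G_v(−)_⟨F_l^⋇⟩` on the labelled copies as soon as `m` intertwines the actions on the constants along the identification of the
Galois groups (`φ`; in print `G_v(Π_v▶) ⥲ G_v(M^Θ_*▶(†F_v)) ⥲ G_v(M^Θ_*(†F_v))`). [cite: Mochizuki2012, Cor 3.7 (i) p.111] -/
theorem piIso_diagonalAction_compat {G : Type*} {G' : Type*} (φ : G → G') (β : G → MulAut M) (β' : G' → MulAut M')
    (m : M ≃* M') (hm : ∀ (g : G) (y : M), m (β g y) = β' (φ g) (m y)) (g : G) (x : T → M) :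
    piIso T m (piIso T (β g) x) = piIso T (β' (φ g)) (piIso T m x) := by
  funext t
  exact hm g (x t)

end Transport

/-! ### 2. Cor 3.7 (i): the compatible collections of isomorphisms induced by `M^Θ_*(Π_v) ⥲ M^Θ_*(†F_v)` -/

section FirstDisplay

variable {P : Type u} [Group P] {P' : Type u} [Group P'] {E : ThetaEnvData.{u, v} P} {E' : ThetaEnvData.{u, v} P'}
  (I : ThetaEnvData.Iso E E') {T : Type w} {M : Type*} {M' : Type*} [CommMonoid M] [CommMonoid M']
  (r : T → (E.H →* M)) (r' : T → (E'.H →* M')) (m : M ≃* M')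

/-- **IUTchII:Cor3.7(i)** (kurims p.111): the value-profile of the transported theta class is the transported value-profile,
`(r'_t (I θ))_t = m ∘ (r_t θ)_t`, under the functoriality input `hcomp` of the restriction algorithm. [cite: Mochizuki2012, Cor 3.7 (i) p.111] -/
theorem pi_restriction_iso (hcomp : ∀ (t : T) (x : E.H), r' t (I.e x) = m (r t x)) (x : E.H) :
    MonoidHom.pi r' (I.e x) = piIso T m (MonoidHom.pi r x) := by
  funext t
  exact hcomp t x

/-- **IUTchII:Cor3.7(i)** (kurims p.111 l.21 – p.112 l.6), FIRST DISPLAY: given the Π_v-side restriction isomorphism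
`e₁ : Ψ^ι_env(M^Θ_*(Π_v)) ⥲ Ψ_ξ(M^Θ_*(Π_v))` of Cor 3.5 (ii) (pinned to the restriction), an isomorphism `I` of theta-environment
data INDUCES (a) the middle isomorphism `γ : Ψ_ξ(M^Θ_*(Π_v)) ⥲ Ψ_{m∘ξ}(M^Θ_*(†F_v))` pinned to `piIso T m` and (b) the †F_v-side
restriction isomorphism `e₂ : Ψ^{ι'}_env(M^Θ_*(†F_v)) ⥲ Ψ_{m∘ξ}(M^Θ_*(†F_v))` pinned to the restriction `r'`, such that (c) the square
with the functoriality isomorphism `I.thetaMonoidIso ι : Ψ^ι_env(M^Θ_*(Π_v)) ⥲ Ψ^{ι'}_env(M^Θ_*(†F_v))` of Prop 3.4 COMMUTES —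
«compatible [in the evident sense] collections of isomorphisms». [cite: Mochizuki2012, Cor 3.7 (i) p.111] -/
theorem cor37_i_square (hcomp : ∀ (t : T) (x : E.H), r' t (I.e x) = m (r t x)) {ι : E.Iota} {ξ : T → M}
    (e₁ : E.thetaMonoid ι ≃* gaussianMonoid ξ)
    (he₁ : ∀ y, ((e₁ y : gaussianMonoid ξ) : T → M) = MonoidHom.pi r y) :
    ∃ (γ : gaussianMonoid ξ ≃* gaussianMonoid (fun t => m (ξ t)))
      (e₂ : E'.thetaMonoid (I.iota ι) ≃* gaussianMonoid (fun t => m (ξ t))),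
      (∀ x, ((γ x : gaussianMonoid (fun t => m (ξ t))) : T → M') = piIso T m x) ∧
      (∀ y, ((e₂ y : gaussianMonoid (fun t => m (ξ t))) : T → M') = MonoidHom.pi r' y) ∧
      ∀ x : E.thetaMonoid ι, e₂ (I.thetaMonoidIso ι x) = γ (e₁ x) := by
  obtain ⟨γ, hγ⟩ := exists_gaussianMonoidIso m ξ
  refine ⟨γ, (I.thetaMonoidIso ι).symm.trans (e₁.trans γ), hγ, fun y => ?_, fun x => ?_⟩
  · rw [MulEquiv.trans_apply, MulEquiv.trans_apply, hγ, he₁]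
    have hy : (y : E'.H) = I.e (((I.thetaMonoidIso ι).symm y : E.thetaMonoid ι) : E.H) := by
      rw [← ThetaEnvData.Iso.coe_restrict_apply I _ _ (I.map_thetaMonoid ι)]
      exact congrArg Subtype.val ((I.thetaMonoidIso ι).apply_symm_apply y).symm
    rw [hy, pi_restriction_iso I r r' m hcomp]
  · rw [MulEquiv.trans_apply, MulEquiv.trans_apply, MulEquiv.symm_apply_apply]

/-- **IUTchII:Cor3.7(i)** (kurims p.111): the †F_v-side restriction isomorphism of the first display is UNIQUE among isomorphisms
whose underlying map is the restriction (so the induced collection does not depend on the choices made in `cor37_i_square`).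
[cite: Mochizuki2012, Cor 3.7 (i) p.111] -/
theorem cor37_i_restrictionIso_unique {ι' : E'.Iota} {ξ' : T → M'}
    (e₂ e₂' : E'.thetaMonoid ι' ≃* gaussianMonoid ξ')
    (he₂ : ∀ y, ((e₂ y : gaussianMonoid ξ') : T → M') = MonoidHom.pi r' y)
    (he₂' : ∀ y, ((e₂' y : gaussianMonoid ξ') : T → M') = MonoidHom.pi r' y) : e₂ = e₂' :=
  MulEquiv.ext fun y => Subtype.ext ((he₂ y).trans (he₂' y).symm)

/-- **IUTchII:Cor3.7(i)** (kurims p.111 «… ⥲ Ψ_ξ(M^Θ_*(†F_v)) ⥲ Ψ_{F_ξ}(†F_v)», lower right-hand portion «obtained by applying the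
right-hand portion of the third display of Corollary 3.6, (ii)»): composing the Π_v-side restriction isomorphism, the middle
isomorphism and abc-iut-w4-d004's Cor 3.6 (ii) transport along the labelled Kummer copies `e : (Ψ_{†C_v})_t ⥲ Ψ_cns,t` yields the
END-TO-END isomorphism `Ψ^ι_env(M^Θ_*(Π_v)) ⥲ Ψ_{F_ξ}(†F_v)`, PINNED: read through the Kummer copies it is «transport ∘ restriction».
[cite: Mochizuki2012, Cor 3.7 (i) p.111] -/
theorem cor37_i_chain {N : Type*} [CommMonoid N] {ι : E.Iota} {ξ : T → M}
    (e₁ : E.thetaMonoid ι ≃* gaussianMonoid ξ)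
    (he₁ : ∀ y, ((e₁ y : gaussianMonoid ξ) : T → M) = MonoidHom.pi r y) (e : N ≃* M') :
    ∃ Φ : E.thetaMonoid ι ≃* frobenioidGaussianMonoid e (fun t => m (ξ t)),
      ∀ y, piIso T e ((Φ y : frobenioidGaussianMonoid e (fun t => m (ξ t))) : T → N) =
        piIso T m (MonoidHom.pi r y) := by
  obtain ⟨γ, hγ⟩ := exists_gaussianMonoidIso m ξ
  obtain ⟨ψ, hψ⟩ := exists_transportIso e (fun t => m (ξ t))
  refine ⟨e₁.trans (γ.trans ψ.symm), fun y => ?_⟩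
  rw [MulEquiv.trans_apply, MulEquiv.trans_apply, ← hψ, MulEquiv.apply_symm_apply, hγ, he₁]

/-- **IUTchII:Cor3.7(i)** (kurims p.111 l.65 – p.112 l.6), SECOND DISPLAY «obtained from the first display by considering the units
[denoted by means of a superscript “×”]»: the unit-group isomorphisms `Ψ^ι_env(…)^× ⥲ Ψ_ξ(…)^× ⥲ …` are the restrictions
(`Units.mapEquiv`) of the isomorphisms of the first display, and their square commutes as well. [cite: Mochizuki2012, Cor 3.7 (i) p.112] -/
theorem cor37_i_units_square {ι : E.Iota} {ξ : T → M} {ξ' : T → M'}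
    (e₁ : E.thetaMonoid ι ≃* gaussianMonoid ξ) (γ : gaussianMonoid ξ ≃* gaussianMonoid ξ')
    (e₂ : E'.thetaMonoid (I.iota ι) ≃* gaussianMonoid ξ')
    (hsq : ∀ x : E.thetaMonoid ι, e₂ (I.thetaMonoidIso ι x) = γ (e₁ x)) (u : (E.thetaMonoid ι)ˣ) :
    Units.mapEquiv e₂ (Units.mapEquiv (I.thetaMonoidIso ι) u) = Units.mapEquiv γ (Units.mapEquiv e₁ u) :=
  Units.ext (by simpa only [Units.coe_mapEquiv] using hsq (u : E.thetaMonoid ι))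

/-- **IUTchII:Cor3.7(i)** (kurims p.111), units: under the Π_v-side restriction the units `M^×_TM` go to DIAGONAL unit families
(`Ψ_ξ^× = Ψ^×_cns,⟨F_l^⋇⟩`, Cor 3.5 (ii)/(iii)), and the middle transport carries diagonal units to diagonal units — the unit rows of
both displays match label-independently. [cite: Mochizuki2012, Cor 3.7 (i) p.112] -/
theorem cor37_i_units_diagonal (hU : ∀ u ∈ E.units, ∃ c : Mˣ, ∀ t, r t u = c) {u : E.H} (hu : u ∈ E.units) :
    MonoidHom.pi r u ∈ unitDiagonal T M ∧ piIso T m (MonoidHom.pi r u) ∈ unitDiagonal T M' := by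
  obtain ⟨c, hc⟩ := hU u hu
  have h1 : MonoidHom.pi r u = fun _ => (c : M) := funext fun t => hc t
  refine ⟨⟨c, h1⟩, ?_⟩
  rw [← map_piIso_unitDiagonal (T := T) m]
  exact Submonoid.mem_map_of_mem _ ⟨c, h1⟩

end FirstDisplay

/-! ### 3. Cor 3.7 (ii): uniradiality of Gaussian monoids, from the uniradiality content of Prop 3.4 (ii) -/

section Uniradial

open CategoryTheory

variable {S : ThetaSetting.{u}} (A : AbsTopMonoids S) (G : IsoClass S.Gk)

/-- The torsion subgroup is carried onto the torsion subgroup by a group isomorphism (bookkeeping for `U^{×μ} := U/U_tors`).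
[cite: Mochizuki2012, Cor 3.7 (ii) p.112] -/
theorem map_torsion_eq_of_mulEquiv {U : Type u} {U' : Type v} [CommGroup U] [CommGroup U'] (ι : U ≃* U') :
    (CommGroup.torsion U).map (ι : U →* U') = CommGroup.torsion U' := by
  ext y
  simp only [Subgroup.mem_map, CommGroup.mem_torsion, MonoidHom.coe_coe]
  constructor
  · rintro ⟨x, hx, rfl⟩
    exact ι.toMonoidHom.isOfFinOrder hx
  · intro hy
    exact ⟨ι.symm y, by simpa using ι.symm.toMonoidHom.isOfFinOrder hy, ι.apply_symm_apply y⟩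

/-- **IUTchII:Cor3.7(ii)** (kurims p.112 l.7–37 «Uniradiality of Gaussian Monoids»): the functorial algorithm `Π_v ↦ Ψ_gau(M^Θ_*(Π_v))`
is computed through the constant monoid and the cyclotomic rigidity isomorphism of Cor 1.11 (b) («composing the algorithms of
Proposition 1.2, (i); Corollary 3.5, (ii), (iii) … the use of the surjection of Remark 1.11.5, (i), in the algorithms of Proposition
3.1, (ii), and Corollary 3.5, (ii)»), so the checkable uniradiality content of Prop 3.4 (ii) TRANSPORTS, relative to the
isomorphisms of (i), to the pair `G_v(M^Θ_*(†F_v))_⟨F_l^⋇⟩ ↷ Ψ_{F_ξ}(†F_v)^{×μ}`: for ANY `G`-equivariant identification `ιU` of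
`O^×(G)` with the unit group `U` of the Frobenioid-theoretic Gaussian monoid (the diagonal of Cor 3.6 (iii)), there is an
automorphism `ψ` of `U^{×μ} = U/U_tors` which (1) commutes with every `G`-action on `U^{×μ}` compatible with the one on `U`,
(2) IS induced by an automorphism of the pair `G ↷ U` lying over `1 ∈ Aut(G)` («which arise from automorphisms of … the pair
`G ↷ Ψ_{F_ξ}(†F_v)^×` [cf. Remarks 1.11.1, (i), (b); 1.8.1]»), and (3) is induced through `ιU` by NO automorphism of the TM-pair
`G ↷ O^⊳(G)` over `1` — «fail to be compatible … only admits a uniradial formulation». [cite: Mochizuki2012, Cor 3.7 (ii) p.112] -/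
theorem cor37ii_uniradialContent_of_prop34ii (h : Prop34iiUniradialContent A G) {U : Type u} [CommGroup U]
    (act : G.G →* MulAut U) (ιU : A.Ounits G ≃* U)
    (hι : ∀ (g : G.G) (x : A.Ounits G), ιU (A.actOunits G g x) = act g (ιU x)) :
    ∃ ψ : MulAut (U ⧸ CommGroup.torsion U),
      (∀ actμ : G.G → (U ⧸ CommGroup.torsion U →* U ⧸ CommGroup.torsion U),
          (∀ (g : G.G) (x : U), actμ g (QuotientGroup.mk x) = QuotientGroup.mk (act g x)) →
          ∀ (g : G.G) (y : U ⧸ CommGroup.torsion U), ψ (actμ g y) = actμ g (ψ y)) ∧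
      (∃ p : PairAut G U act, PairAut.forget p = 1 ∧
          ∀ x : U, (QuotientGroup.mk (p.1.2 x) : U ⧸ CommGroup.torsion U) = ψ (QuotientGroup.mk x)) ∧
      ∀ q : PairAut G (A.Otri G) (A.actOtri G), PairAut.forget q = 1 →
          ∃ x : A.Ounits G,
            (QuotientGroup.mk (ιU (Units.map q.1.2.toMonoidHom x)) : U ⧸ CommGroup.torsion U) ≠
              ψ (QuotientGroup.mk (ιU x)) := by
  obtain ⟨ψ₀, -, ⟨p₀, hp₀1, hp₀⟩, hno⟩ := h
  -- the identification of the `×μ`-quotients induced by `ιU`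
  let ιμ : A.Oxmu G ≃* U ⧸ CommGroup.torsion U :=
    QuotientGroup.congr (A.Omu G) (CommGroup.torsion U) ιU (map_torsion_eq_of_mulEquiv ιU)
  have hιμ : ∀ x : A.Ounits G, ιμ (QuotientGroup.mk x) = QuotientGroup.mk (ιU x) := fun x => rfl
  -- the transported pair-automorphism of `G ↷ U` over `1`
  have hp₀11 : p₀.1.1 = 1 := hp₀1
  have hp₀mem : ∀ (g : G.G) (x : A.Ounits G), p₀.1.2 (A.actOunits G g x) = A.actOunits G g (p₀.1.2 x) := by
    intro g x
    have h2 := p₀.2 g x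
    rw [hp₀11] at h2
    exact h2
  have hpmem : ((1 : Aut G), ιU.symm.trans (p₀.1.2.trans ιU)) ∈ PairAut G U act := by
    intro g y
    change ιU (p₀.1.2 (ιU.symm (act g y))) = act g (ιU (p₀.1.2 (ιU.symm y)))
    obtain ⟨x, rfl⟩ := ιU.surjective y
    rw [← hι, ιU.symm_apply_apply, ιU.symm_apply_apply, hp₀mem, hι]
  -- the transported `×μ`-automorphism and its defining identity on classes of `ιU z`
  have hK : ∀ z : A.Ounits G,
      (ιμ.symm.trans (ψ₀.trans ιμ)) (QuotientGroup.mk (ιU z)) = QuotientGroup.mk (ιU (p₀.1.2 z)) := by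
    intro z
    rw [MulEquiv.trans_apply, MulEquiv.trans_apply, ← hιμ z, MulEquiv.symm_apply_apply, ← hp₀ z, hιμ]
  refine ⟨ιμ.symm.trans (ψ₀.trans ιμ), ?_, ⟨⟨_, hpmem⟩, rfl, fun y => ?_⟩, fun q hq => ?_⟩
  · -- (1) equivariance for every compatible `×μ`-action, from (2)
    intro actμ hactμ g y
    obtain ⟨y, rfl⟩ := QuotientGroup.mk_surjective y
    obtain ⟨x, rfl⟩ := ιU.surjective y
    rw [hactμ, ← hι, hK, hp₀mem, hι, ← hactμ, ← hK]
  · -- (2) `ψ` is induced by the transported pair-automorphism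
    obtain ⟨x, rfl⟩ := ιU.surjective y
    change (QuotientGroup.mk (ιU (p₀.1.2 (ιU.symm (ιU x)))) : U ⧸ CommGroup.torsion U) = _
    rw [ιU.symm_apply_apply, hK]
  · -- (3) not induced, through `ιU`, by any automorphism of `G ↷ O^⊳(G)` over `1`
    obtain ⟨x, hx⟩ := hno q hq
    refine ⟨x, fun habs => hx (ιμ.injective ?_)⟩
    have hR : (ιμ.symm.trans (ψ₀.trans ιμ)) (QuotientGroup.mk (ιU x)) = ιμ (ψ₀ (QuotientGroup.mk x)) := by
      rw [MulEquiv.trans_apply, MulEquiv.trans_apply, ← hιμ x, MulEquiv.symm_apply_apply]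
    rw [hιμ, ← hR]
    exact habs

/-- **IUTchII:Cor3.7(ii)** from the named facts `Rmk1111_a` ([AbsTopIII] Prop. 3.2 (iv)) and `Rmk1111_b` ([AbsTopIII] Prop. 3.3 (ii))
of Remark 1.11.1 (i) (the references «[cf. Remarks 1.11.1, (i), (b); 1.8.1]» of print), the compatibility of the `Ẑ^×`-action on
`O^×(G)` with `Ẑ^× → Ism(G) ↷ O^{×μ}(G)` and one `u ∈ Ẑ^×` acting non-trivially on `O^{×μ}(G)` (abc-iut-w5-d169's
`prop34iiUniradialContent_of_rmk1111`, p416097): the Gaussian uniradiality content at every equivariant model `U` of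
`Ψ_{F_ξ}(†F_v)^×`. CONDITIONAL on the two named facts by design (FACT-LIST rows, consumed by name).
[cite: Mochizuki2012, Cor 3.7 (ii) p.112] -/
theorem cor37ii_uniradialContent_of_rmk1111
    (zhatPow : ∀ G : IsoClass S.Gk, ZHatUnits →* MulAut (A.Ounits G))
    (ha : Rmk1111_a A) (hb : Rmk1111_b A zhatPow)
    (hcompat : ∀ (u : ZHatUnits) (x : A.Ounits G),
      (QuotientGroup.mk (zhatPow G u x) : A.Oxmu G) = A.actIsm G (A.toIsm G u) (QuotientGroup.mk x))
    (u : ZHatUnits) (hu : A.actIsm G (A.toIsm G u) ≠ 1) {U : Type u} [CommGroup U]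
    (act : G.G →* MulAut U) (ιU : A.Ounits G ≃* U)
    (hι : ∀ (g : G.G) (x : A.Ounits G), ιU (A.actOunits G g x) = act g (ιU x)) :
    ∃ ψ : MulAut (U ⧸ CommGroup.torsion U),
      (∀ actμ : G.G → (U ⧸ CommGroup.torsion U →* U ⧸ CommGroup.torsion U),
          (∀ (g : G.G) (x : U), actμ g (QuotientGroup.mk x) = QuotientGroup.mk (act g x)) →
          ∀ (g : G.G) (y : U ⧸ CommGroup.torsion U), ψ (actμ g y) = actμ g (ψ y)) ∧
      (∃ p : PairAut G U act, PairAut.forget p = 1 ∧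
          ∀ x : U, (QuotientGroup.mk (p.1.2 x) : U ⧸ CommGroup.torsion U) = ψ (QuotientGroup.mk x)) ∧
      ∀ q : PairAut G (A.Otri G) (A.actOtri G), PairAut.forget q = 1 →
          ∃ x : A.Ounits G,
            (QuotientGroup.mk (ιU (Units.map q.1.2.toMonoidHom x)) : U ⧸ CommGroup.torsion U) ≠
              ψ (QuotientGroup.mk (ιU x)) :=
  cor37ii_uniradialContent_of_prop34ii A G (prop34iiUniradialContent_of_rmk1111 A zhatPow ha hb G hcompat u hu) act ιU hι

/-- **IUTchII:Cor3.7(ii)**, the tautological model `U := O^×(G)` (identity identification): the Gaussian-shaped content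
specialises back to (and is therefore exactly as strong as) the Prop 3.4 (ii) content — sanity check of the transport.
[cite: Mochizuki2012, Cor 3.7 (ii) p.112] -/
theorem cor37ii_uniradialContent_self (h : Prop34iiUniradialContent A G) :
    ∃ ψ : MulAut (A.Oxmu G),
      (∃ p : PairAut G (A.Ounits G) (A.actOunits G), PairAut.forget p = 1 ∧
          ∀ x : A.Ounits G, (QuotientGroup.mk (p.1.2 x) : A.Oxmu G) = ψ (QuotientGroup.mk x)) ∧
      ∀ q : PairAut G (A.Otri G) (A.actOtri G), PairAut.forget q = 1 →
          ∃ x : A.Ounits G, (QuotientGroup.mk (Units.map q.1.2.toMonoidHom x) : A.Oxmu G) ≠ ψ (QuotientGroup.mk x) := by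
  obtain ⟨ψ, -, hp, hq⟩ :=
    cor37ii_uniradialContent_of_prop34ii A G h (A.actOunits G) (MulEquiv.refl _) (fun _ _ => rfl)
  exact ⟨ψ, hp, hq⟩

end Uniradial

end TemperedThetaMonoids

end Literature.IUT.HodgeArakelov
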